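import Literature.NumberTheory.DiophantineGeometry.GenEllDeCoverFarFromCusps
import Literature.NumberTheory.DiophantineGeometry.GenEllDeFibres

/-!
# [GenEll] Thm 2.1 for `ℙ¹` (route piece W7, adapter): `φ(P)` far from the cusps — stated in the
# cell's common conventions (`e = 2k+1`, `t = ((1−2x) + r^{k+2})/(r(1−2x))`, `X_φ = De.Xphi k B`)

Support file for `GenEllTwo` (stmt-ABC-19679; S. Mochizuki, *Arithmetic elliptic curves in general
position*, Math. J. Okayama Univ. **52** (2010), Thm. 2.1 (ii) ⇒ (i), proof pp. 12–13; package map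
`GENELLTWO-P1ROUTE.md` of seat abc-iut-S6 §5, W7 «properness»; S6 STATUS 2026-08-26 00:32:17Z:
«hZfar = W7 … state your main theorems so that they produce these hypotheses VERBATIM
(point-indexed, constants uniform in P)»).

`GenEllDeCoverFarFromCusps.exists_farFromCusps_phi_of_x_far` is restated here
* with the exponent written `e = 2k+1` and `t(x, r) = ((1 − 2x) + r^{k+2}) / (r·(1 − 2x))`, the
  conventions of `GenEllDeFibres` (W5-F) / W4a / S6 (D3) — the two forms of `t` agree off the poles
  (`t_eq_div`);
* with the avoidance hypothesis phrased through W5-F's finite set `De.Xphi k B ⊂ L` (`L = ℂ`,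
  `L = ℚ̄₂^∧ = PadicAlgCl 2`) for ANY finite `B ⊂ L` containing the roots of `p`, `q`, `p − q`
  (`β = p/q`, `B ⊇ β⁻¹{0, 1, ∞} ∖ {∞}`), in the `dist` form produced by the W8 covering lemma
  (`exists_menu_cover_conjugates`: `r ≤ dist (σ y) (τ a)`);
* point-indexed: for `P : NFPoint` whose conjugates are `ρ`-far from `X_φ` at `∞` and at `2`, and
  any presentation `ι : P.F → F`, `r ∈ F` of a point of `D_e` over `P` (`r^{2k+1} = ιx(1 − ιx)`),
  `φ = β(t(ιx, r))` presented over `F` is `NFPoint.FarFromCusps {2} ρ'`, `ρ'` uniform in `P` and in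
  `F` of bounded degree (`exists_farFromCusps_phi_of_base`); `roots_subset_toFinset` supplies the
  canonical `B = roots of p·q·(p−q)`.

Classical and undisputed; nothing here bears on [IUTchIII] Cor. 3.12.
-/

namespace Literature.NumberTheory.DiophantineGeometry.GenEll

open Polynomial

universe u

section Forms

variable {L : Type u} [Field L]

/-- The two forms of the Belyi-type function `t` on `D_e` agree off the poles:
`1/r + r^{k+1}/(1−2x) = ((1−2x) + r^{k+2})/(r(1−2x))`. [folklore] -/
private theorem t_eq_div (k : ℕ) {x r : L} (hr : r ≠ 0) (hs : 1 - 2 * x ≠ 0) :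
    r⁻¹ + r ^ (k + 1) / (1 - 2 * x) = ((1 - 2 * x) + r ^ (k + 2)) / (r * (1 - 2 * x)) := by
  field_simp
  ring

/-- A non-pole point of `D_e` whose `t`-value is a root of `p`, `q` or `p − q` has its
`x`-coordinate in `X_φ = De.Xphi k B` for every finite `B` containing these roots. [folklore] -/
private theorem fst_mem_Xphi [CharZero L] (k : ℕ) {p q : ℚ[X]} {B : Finset L}
    (hB : ∀ z : L, (aeval z p = 0 ∨ aeval z q = 0 ∨ aeval z (p - q) = 0) → z ∈ B)
    {P' : L × L} (hcurve : P'.2 ^ (2 * k + 1) = P'.1 * (1 - P'.1)) (hr : P'.2 ≠ 0)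
    (hs : 1 - 2 * P'.1 ≠ 0)
    (hfib : aeval (P'.2⁻¹ + P'.2 ^ (k + 1) / (1 - 2 * P'.1)) p = 0 ∨
      aeval (P'.2⁻¹ + P'.2 ^ (k + 1) / (1 - 2 * P'.1)) q = 0 ∨
      aeval (P'.2⁻¹ + P'.2 ^ (k + 1) / (1 - 2 * P'.1)) (p - q) = 0) :
    P'.1 ∈ De.Xphi k B := by
  rw [De.mem_Xphi]
  refine ⟨P'.2, De.mem_Ephi_iff_t.mpr ⟨hcurve, hr, hs, ?_⟩⟩
  rw [← t_eq_div k hr hs]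
  exact hB _ hfib

/-- The canonical choice of `B`: the roots in `L` of `p·q·(p − q)` contain every root of `p`, of `q`
and of `p − q` (`p, q ≠ 0`, `p ≠ q`). [folklore] -/
private theorem mem_roots_toFinset [CharZero L] [DecidableEq L] {p q : ℚ[X]} (hp0 : p ≠ 0)
    (hq0 : q ≠ 0) (hne : p ≠ q) (z : L)
    (hz : aeval z p = 0 ∨ aeval z q = 0 ∨ aeval z (p - q) = 0) :
    z ∈ ((p * q * (p - q)).map (algebraMap ℚ L)).roots.toFinset := by
  have hpq : p * q * (p - q) ≠ 0 := mul_ne_zero (mul_ne_zero hp0 hq0) (sub_ne_zero.mpr hne)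
  rw [Multiset.mem_toFinset, mem_roots ((Polynomial.map_ne_zero_iff (algebraMap ℚ L).injective).mpr
    hpq), IsRoot.def, eval_map_algebraMap, map_mul, map_mul, map_sub]
  rcases hz with h | h | h
  · rw [h, zero_mul, zero_mul]
  · rw [h, mul_zero, zero_mul]
  · rw [map_sub] at h
    rw [h, mul_zero]

end Forms

section NumberField

/-- **W7 in the common conventions, point-indexed** ([GenEll] Thm 2.1 proof p. 12: «we may apply
the compactly bounded subset to φ(ξ_V) whenever the conjugates of ξ stay outside the support of
φ⁻¹{0,1,∞}»).  Fix `k` (`e = 2k+1`), `β = p/q` (`p, q ∈ ℚ[X]` of the same degree `n` as `p − q`,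
`p, q ≠ 0`, `p ≠ q`), `ρ > 0`, a degree bound `N`, and finite sets `Bℂ ⊂ ℂ`, `B₂ ⊂ ℚ̄₂^∧`
containing the roots of `p`, `q`, `p − q`.  Then there is `ρ' ∈ (0, 1/2]` such that for every
`P : NFPoint` whose conjugates are `ρ`-far (in `dist`) from `X_φ(ℂ) = De.Xphi k Bℂ` and from
`X_φ(ℚ̄₂^∧) = De.Xphi k B₂`, every number field `F` of degree `≤ N`, every `ι : P.F →+* F` and every
`r ∈ F` with `r^{2k+1} = ιx(1 − ιx)`, `r ≠ 0`, `1 − 2·ιx ≠ 0`, the point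
`⟨F, β(t)⟩`, `t = ((1−2ιx) + r^{k+2})/(r(1−2ιx))`, is `NFPoint.FarFromCusps {2} ρ'`.
[cite: MochizukiGenEll2010, Thm 2.1 proof p.12] -/
theorem exists_farFromCusps_phi_of_base (k : ℕ) {p q : ℚ[X]} {n : ℕ} (hpn : p.natDegree = n)
    (hqn : q.natDegree = n) (hpqn : (p - q).natDegree = n) (hp0 : p ≠ 0) (hq0 : q ≠ 0)
    (hne : p ≠ q) {ρ : ℝ} (hρ : 0 < ρ) (N : ℕ) {Bℂ : Finset ℂ}
    (hBℂ : ∀ z : ℂ, (aeval z p = 0 ∨ aeval z q = 0 ∨ aeval z (p - q) = 0) → z ∈ Bℂ)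
    {B₂ : Finset (PadicAlgCl 2)}
    (hB₂ : ∀ z : PadicAlgCl 2, (aeval z p = 0 ∨ aeval z q = 0 ∨ aeval z (p - q) = 0) → z ∈ B₂) :
    ∃ ρ' : ℝ, 0 < ρ' ∧ ρ' ≤ 1 / 2 ∧
      ∀ P : NFPoint,
        (∀ σ : P.F →+* ℂ, ∀ ξ ∈ De.Xphi k Bℂ, ρ ≤ dist (σ P.x) ξ) →
        (∀ σ : P.F →+* PadicAlgCl 2, ∀ ξ ∈ De.Xphi k B₂, ρ ≤ dist (σ P.x) ξ) →
      ∀ (F : Type) [Field F] [NumberField F], Module.finrank ℚ F ≤ N →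
      ∀ (ι : P.F →+* F) (r : F), r ^ (2 * k + 1) = ι P.x * (1 - ι P.x) → r ≠ 0 →
        1 - 2 * ι P.x ≠ 0 →
      NFPoint.FarFromCusps ({2} : Finset ℕ) ρ'
        ⟨F, aeval (((1 - 2 * ι P.x) + r ^ (k + 2)) / (r * (1 - 2 * ι P.x))) p /
            aeval (((1 - 2 * ι P.x) + r ^ (k + 2)) / (r * (1 - 2 * ι P.x))) q⟩ := by
  obtain ⟨ρ', h0, h1, h⟩ := exists_farFromCusps_phi_of_x_far (e := 2 * k + 1) (k := k + 1)
    (by omega) (by omega) hpn hqn hpqn hp0 hq0 hne hρ N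
  refine ⟨ρ', h0, h1, fun P hPℂ hP₂ F _ _ hF ι r hcurve hr hs => ?_⟩
  have key := h F hF (ι P.x) r hcurve hr hs ?_ ?_
  · rwa [t_eq_div k hr hs] at key
  · intro σ P' hc hr' hs' hfib
    rw [← dist_eq_norm, ← RingHom.comp_apply]
    exact hPℂ (σ.comp ι) P'.1 (fst_mem_Xphi k hBℂ hc hr' hs' hfib)
  · intro σ P' hc hr' hs' hfib
    rw [← dist_eq_norm, ← RingHom.comp_apply]
    exact hP₂ (σ.comp ι) P'.1 (fst_mem_Xphi k hB₂ hc hr' hs' hfib)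

/-- **W7 in the common conventions, canonical `B`**: as `exists_farFromCusps_phi_of_base` with
`Bℂ`, `B₂` the roots of `p·q·(p − q)` in `ℂ` resp. `ℚ̄₂^∧` (so `De.Xphi k B = X_φ` exactly).
[cite: MochizukiGenEll2010, Thm 2.1 proof p.12] -/
theorem exists_farFromCusps_phi_of_base_roots (k : ℕ) {p q : ℚ[X]} {n : ℕ}
    (hpn : p.natDegree = n) (hqn : q.natDegree = n) (hpqn : (p - q).natDegree = n) (hp0 : p ≠ 0)
    (hq0 : q ≠ 0) (hne : p ≠ q) {ρ : ℝ} (hρ : 0 < ρ) (N : ℕ) :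
    ∃ ρ' : ℝ, 0 < ρ' ∧ ρ' ≤ 1 / 2 ∧
      ∀ P : NFPoint,
        (∀ σ : P.F →+* ℂ, ∀ ξ ∈ De.Xphi k
            (open scoped Classical in ((p * q * (p - q)).map (algebraMap ℚ ℂ)).roots.toFinset),
          ρ ≤ dist (σ P.x) ξ) →
        (∀ σ : P.F →+* PadicAlgCl 2, ∀ ξ ∈ De.Xphi k
            (open scoped Classical in
              ((p * q * (p - q)).map (algebraMap ℚ (PadicAlgCl 2))).roots.toFinset),
          ρ ≤ dist (σ P.x) ξ) →
      ∀ (F : Type) [Field F] [NumberField F], Module.finrank ℚ F ≤ N →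
      ∀ (ι : P.F →+* F) (r : F), r ^ (2 * k + 1) = ι P.x * (1 - ι P.x) → r ≠ 0 →
        1 - 2 * ι P.x ≠ 0 →
      NFPoint.FarFromCusps ({2} : Finset ℕ) ρ'
        ⟨F, aeval (((1 - 2 * ι P.x) + r ^ (k + 2)) / (r * (1 - 2 * ι P.x))) p /
            aeval (((1 - 2 * ι P.x) + r ^ (k + 2)) / (r * (1 - 2 * ι P.x))) q⟩ := by
  classical
  exact exists_farFromCusps_phi_of_base k hpn hqn hpqn hp0 hq0 hne hρ N
    (mem_roots_toFinset hp0 hq0 hne) (mem_roots_toFinset hp0 hq0 hne)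

/-- **W7 in the common conventions, re-presented over `ℚ(φ)`**: under the hypotheses of
`exists_farFromCusps_phi_of_base`, the minimal re-presentation
`(⟨F, ·⟩ : NFPoint).imageAt (β(t))` is `FarFromCusps {2} ρ'` as well (this is the shape
`(Z P).FarFromCusps {2} ρ'` of `GenEllPhiMechanism.vojtaIneq_of_belyi_mechanism`, with
`Z P := (Q P).imageAt φ`). [cite: MochizukiGenEll2010, Thm 2.1 proof p.12] -/
theorem exists_farFromCusps_phi_imageAt_of_base (k : ℕ) {p q : ℚ[X]} {n : ℕ}
    (hpn : p.natDegree = n) (hqn : q.natDegree = n) (hpqn : (p - q).natDegree = n) (hp0 : p ≠ 0)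
    (hq0 : q ≠ 0) (hne : p ≠ q) {ρ : ℝ} (hρ : 0 < ρ) (N : ℕ) {Bℂ : Finset ℂ}
    (hBℂ : ∀ z : ℂ, (aeval z p = 0 ∨ aeval z q = 0 ∨ aeval z (p - q) = 0) → z ∈ Bℂ)
    {B₂ : Finset (PadicAlgCl 2)}
    (hB₂ : ∀ z : PadicAlgCl 2, (aeval z p = 0 ∨ aeval z q = 0 ∨ aeval z (p - q) = 0) → z ∈ B₂) :
    ∃ ρ' : ℝ, 0 < ρ' ∧ ρ' ≤ 1 / 2 ∧
      ∀ P : NFPoint,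
        (∀ σ : P.F →+* ℂ, ∀ ξ ∈ De.Xphi k Bℂ, ρ ≤ dist (σ P.x) ξ) →
        (∀ σ : P.F →+* PadicAlgCl 2, ∀ ξ ∈ De.Xphi k B₂, ρ ≤ dist (σ P.x) ξ) →
      ∀ (F : Type) [Field F] [NumberField F], Module.finrank ℚ F ≤ N →
      ∀ (ι : P.F →+* F) (r : F), r ^ (2 * k + 1) = ι P.x * (1 - ι P.x) → r ≠ 0 →
        1 - 2 * ι P.x ≠ 0 →
      NFPoint.FarFromCusps ({2} : Finset ℕ) ρ'
        ((⟨F, r⟩ : NFPoint).imageAt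
          (aeval (((1 - 2 * ι P.x) + r ^ (k + 2)) / (r * (1 - 2 * ι P.x))) p /
            aeval (((1 - 2 * ι P.x) + r ^ (k + 2)) / (r * (1 - 2 * ι P.x))) q)) := by
  obtain ⟨ρ', h0, h1, h⟩ := exists_farFromCusps_phi_of_base k hpn hqn hpqn hp0 hq0 hne hρ N hBℂ hB₂
  exact ⟨ρ', h0, h1, fun P hPℂ hP₂ F _ _ hF ι r hcurve hr hs =>
    NFPoint.farFromCusps_imageAt ⟨F, r⟩ _ (h P hPℂ hP₂ F hF ι r hcurve hr hs)⟩

end NumberField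

end Literature.NumberTheory.DiophantineGeometry.GenEll

/-! ### `hZfar` together with `hZmem`: the re-presented point lies in `U_P(ℚ̄)^{≤ N}` -/

namespace Literature.NumberTheory.DiophantineGeometry.GenEll

open Polynomial

section Membership

/-- A point `ρ`-far from the cusps with `ρ ≥ 0` lies in `U = ℙ¹ ∖ {0, 1, ∞}`: `x ≠ 0, 1` (read off at
any complex embedding of the presenting number field). [cite: MochizukiGenEll2010, Ex 1.3 (ii) p.6] -/
theorem NFPoint.FarFromCusps.inU {S : Finset ℕ} {ρ : ℝ} {P : NFPoint}
    (h : NFPoint.FarFromCusps S ρ P) (hρ : 0 ≤ ρ) : P.InU := by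
  obtain ⟨σ⟩ := (inferInstance : Nonempty (P.F →+* ℂ))
  obtain ⟨h0, -, h1⟩ := h.1 σ
  refine ⟨fun hx => ?_, fun hx => ?_⟩
  · rw [hx, map_zero, norm_zero] at h0
    exact absurd h0 (not_lt.mpr hρ)
  · rw [hx, map_one, sub_self, norm_zero] at h1
    exact absurd h1 (not_lt.mpr hρ)

/-- **W7 in the common conventions, `hZfar` and `hZmem` at once.**  Under the hypotheses of
`exists_farFromCusps_phi_of_base` (conjugates of `P` `ρ`-far from `X_φ` at `∞` and at `2`; `(F, ι, r)`
a presentation of the `D_e`-point over `P` with `[F:ℚ] ≤ N`, `r ≠ 0`, `1 − 2·ιx ≠ 0`), the minimal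
re-presentation `Z := (⟨F, r⟩ : NFPoint).imageAt (β(t))` is `FarFromCusps {2} ρ'` AND lies in
`UPle N` (`β(t) ≠ 0, 1` because it is `ρ'`-far from the cusps, `ρ' > 0`; degree `≤ [F:ℚ] ≤ N`) — the
two hypotheses `hZfar`, `hZmem` of `GenEllPhiMechanism.vojtaIneq_of_belyi_mechanism` for the
mechanism PHI, with `ρ'` and `d' := N` uniform in `P`. [cite: MochizukiGenEll2010, Thm 2.1 proof p.12] -/
theorem exists_farFromCusps_phi_imageAt_mem_UPle (k : ℕ) {p q : ℚ[X]} {n : ℕ}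
    (hpn : p.natDegree = n) (hqn : q.natDegree = n) (hpqn : (p - q).natDegree = n) (hp0 : p ≠ 0)
    (hq0 : q ≠ 0) (hne : p ≠ q) {ρ : ℝ} (hρ : 0 < ρ) (N : ℕ) {Bℂ : Finset ℂ}
    (hBℂ : ∀ z : ℂ, (aeval z p = 0 ∨ aeval z q = 0 ∨ aeval z (p - q) = 0) → z ∈ Bℂ)
    {B₂ : Finset (PadicAlgCl 2)}
    (hB₂ : ∀ z : PadicAlgCl 2, (aeval z p = 0 ∨ aeval z q = 0 ∨ aeval z (p - q) = 0) → z ∈ B₂) :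
    ∃ ρ' : ℝ, 0 < ρ' ∧ ρ' ≤ 1 / 2 ∧
      ∀ P : NFPoint,
        (∀ σ : P.F →+* ℂ, ∀ ξ ∈ De.Xphi k Bℂ, ρ ≤ dist (σ P.x) ξ) →
        (∀ σ : P.F →+* PadicAlgCl 2, ∀ ξ ∈ De.Xphi k B₂, ρ ≤ dist (σ P.x) ξ) →
      ∀ (F : Type) [Field F] [NumberField F], Module.finrank ℚ F ≤ N →
      ∀ (ι : P.F →+* F) (r : F), r ^ (2 * k + 1) = ι P.x * (1 - ι P.x) → r ≠ 0 →
        1 - 2 * ι P.x ≠ 0 →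
      NFPoint.FarFromCusps ({2} : Finset ℕ) ρ'
          ((⟨F, r⟩ : NFPoint).imageAt
            (aeval (((1 - 2 * ι P.x) + r ^ (k + 2)) / (r * (1 - 2 * ι P.x))) p /
              aeval (((1 - 2 * ι P.x) + r ^ (k + 2)) / (r * (1 - 2 * ι P.x))) q)) ∧
        (⟨F, r⟩ : NFPoint).imageAt
            (aeval (((1 - 2 * ι P.x) + r ^ (k + 2)) / (r * (1 - 2 * ι P.x))) p /
              aeval (((1 - 2 * ι P.x) + r ^ (k + 2)) / (r * (1 - 2 * ι P.x))) q) ∈ UPle N := by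
  obtain ⟨ρ', h0, h1, h⟩ := exists_farFromCusps_phi_of_base k hpn hqn hpqn hp0 hq0 hne hρ N hBℂ hB₂
  refine ⟨ρ', h0, h1, fun P hPℂ hP₂ F _ _ hF ι r hcurve hr hs => ?_⟩
  have key := h P hPℂ hP₂ F hF ι r hcurve hr hs
  have hU := NFPoint.FarFromCusps.inU key h0.le
  exact ⟨NFPoint.farFromCusps_imageAt ⟨F, r⟩ _ key,
    NFPoint.imageAt_mem_UPle ⟨F, r⟩ hU.1 hU.2 (d := N) hF⟩

end Membership

end Literature.NumberTheory.DiophantineGeometry.GenEll
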